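import Summits.HodgeConjecture.HodgeConjecture.Theses.QbarEnvelope
import Literature.AlgebraicGeometry.HodgeTheory.AbsoluteHodgeClasses

/-!
# Birth skeleton (BC3) of the crux `HCOverNumberFields` (stmt-HodgeConjecture-1070),
# route `QbarEnvelope` — line `birth`: Deligne's absolute-Hodge funnel on arithmetic varieties

`HCOverNumberFields` (rank 3 of `QbarEnvelope`, shared with `BoundaryReadout` rank 4) is the Hodge
conjecture for smooth projective complex varieties DEFINABLE OVER A NUMBER FIELD
(`X ≅ X₀ ×_{K,σ} ℂ`, `K` a number field): `IsSmoothProjective n X → (∃ K σ X₀, X ≅ X₀ ⊗_{K,σ} ℂ) →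
HodgeConjectureFor n X`. The route's thesis is that on such `X` a Hodge class has ARITHMETIC
incarnations (an algebraic de Rham class over a finite extension of `K`, crystalline Frobenii, one
`ℓ`-adic Galois representation) — and the gateway to every one of them is ABSOLUTENESS of the class
(Deligne 1982 §2; Charles–Schnell 2014 §11.2–11.3: an absolute Hodge class on `X/K` has de Rham
component defined over a finite extension of `K`, Cor. 11.3.16, and is a potentially Tate class,
Deligne Prop. 2.9(b)). This line therefore cuts the crux along Deligne's funnel, restricted to
arithmetic varieties, on the tree's REAL carriers (`IsAbsoluteHodgeClass`, `IsConjugateClass`,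
`periodTwist` of `HodgeTheory/AbsoluteHodgeClasses`):

  rational `(p,p)` class `c` on `X/K`
    ⟹ (STUB 1, INFRASTRUCTURE — a theorem in print, absent from the tree) for every `σ ∈ Aut ℂ`
      a `σ`-CONJUGATE `c^σ ∈ H^{2p}(X^σ(ℂ); ℂ)` EXISTS (a conjugation chart: Jouanolou's affine
      torsor `Y → X`, analytifications of `Y`, `Y^σ` (GAGA), the integration de Rham family
      (de Rham), and Grothendieck's algebraic de Rham theorem on the affine `Y`);
    ⟹ (STUB 2, DELIGNE'S ABSOLUTENESS CONJECTURE ON ARITHMETIC VARIETIES — open; Charles–Schnell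
      Conj. 11.2.17 restricted to `X` definable over a number field) every `σ`-conjugate of `c` is
      `(2πi/σ(2πi))ᵖ ·` (a rational `(p,p)` class on `X^σ`);
    ⟹ (`IsAbsoluteHodgeClass n X p c`, assembled in `HCOverNumberFields_of` from STUBS 1–2)
    ⟹ (STUB 3, ABSOLUTE HODGE CLASSES ON ARITHMETIC VARIETIES ARE ALGEBRAIC — open; the
      arithmetic heart: here Tate + Mumford–Tate, `p`-adic variational Hodge and CM tools bite;
      contains the Weil classes on CM abelian varieties of Weil type, which ARE absolute by
      Deligne's theorem and are algebraic in dimension 4 / partly 6 only) `c` is algebraic.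

The composition `HCOverNumberFields_of` is pure logic plus the PROVED tree theorem
`QbarEnvelope.HodgeModels_holds` (= `nonempty_hodgeModel_holds`: the anti-vacuity conjunct
`Nonempty (HodgeModel n X)` of `HodgeConjectureFor`), kernel-checked, no `sorry`. The three stubs
are genuinely different statements (infrastructure theorem / transcendence conjecture / arithmetic
conjecture); none is the crux or the summit reworded: STUB 1 concludes existence of conjugates (no
algebraicity), STUB 2 concludes a conjugation property (implied by HC + "cycle classes are absolute
Hodge", gives nothing algebraic without STUB 3), STUB 3 has the STRONGER hypothesis "absolute Hodge"
(no rational `(p,p)` class is provably absolute without STUBS 1–2).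

## Contents

* `IsDefinableOverNumberField X` — `∃ K number field, σ : K →+* ℂ, X₀/K, X ≅ X₀ ×_{K,σ} ℂ`,
  VERBATIM the hypothesis of the route decl (checked by `hcOverNumberFields_iff`, `Iff.rfl`);
* `stub_conjugate_exists` (STUB 1, theorem in print, L-sized in the tree),
  `stub_conjugate_isHodge_of_numberField` (STUB 2, open), `stub_absoluteHodge_algebraic_of_numberField`
  (STUB 3, open, the load-bearing stub) — `sorry` ONLY here;
* `HCOverNumberFields_of` — the composition stub₁ → stub₂ → stub₃ → the crux BY NAME
  (`Summit.HodgeConjecture.HodgeConjecture.Theses.QbarEnvelope.HCOverNumberFields`), no `sorry`;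
  `HCOverNumberFields_of_stubs` — the crux modulo exactly the three stubs.

Disproof used: none on file (`ledger crux ls stmt-HodgeConjecture-1070`: "(no workfiles yet)" at
registration; `ledger negatives --problem HodgeConjecture` has no statement about varieties over
number fields or absolute Hodge classes). Landed Negative lemmas CHECKED AGAINST (imported in the
scratch check, not here): `Theorems/BallQuotientHodgeAbsolute/Negative/HodgeImpliesAbsoluteHodge`
(`nonempty_conjugationChart_of_isAbsoluteHodgeClass`: any proof of absoluteness must BUILD charts —
that obligation is exactly STUB 1, named, not hidden; `eq_zero_of_forall_isOfHodgeType_isAbsoluteHodgeClass`: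
dropping RATIONALITY from STUB 2 would be absurd — STUB 2 keeps `IsRationalClass c`) and
`…/Negative/ChartConjugationUniqueness` (`conjugates_unique_of_forall_rational`: STUB 2 certifies
single-valued chart conjugation on rational `(p,p)` classes of arithmetic varieties — the fragment of
Grothendieck's comparison theorem the interface's junk analysis rests on; recorded as STUB 2's first
sub-obligation in the line card). No stub is an instance those lemmas refute.
-/

noncomputable section

namespace Summit.HodgeConjecture.HodgeConjecture.Cruxes.HCOverNumberFields.Birth

open CategoryTheory AlgebraicGeometry
open Literature.AlgebraicGeometry.Motives Literature.AlgebraicGeometry.HodgeTheory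
open Summit.HodgeConjecture.HodgeConjecture.Theses.QbarEnvelope (HCOverNumberFields HodgeModels_holds)

/-! ### The arithmetic hypothesis of the crux -/

/-- `X/ℂ` is DEFINABLE OVER A NUMBER FIELD: `X ≅ X₀ ×_{K,σ} ℂ` for a number field `K`, an
embedding `σ : K →+* ℂ` and a `K`-scheme `X₀` — verbatim the hypothesis of
`QbarEnvelope.HCOverNumberFields` (stmt-HodgeConjecture-1070). [folklore] -/
def IsDefinableOverNumberField (X : SchemeOver ℂ) : Prop :=
  ∃ (K : Type) (_ : Field K) (_ : NumberField K) (σ : K →+* ℂ) (X₀ : SchemeOver K),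
    Nonempty (X ≅ (baseChangeHom σ).obj X₀)

/-- READ-BACK: the crux unfolds, definitionally, to "the Hodge conjecture for every smooth projective
complex variety definable over a number field". [folklore] -/
theorem hcOverNumberFields_iff :
    HCOverNumberFields ↔
      ∀ ⦃n : ℕ⦄ ⦃X : SchemeOver ℂ⦄, IsSmoothProjective n X → IsDefinableOverNumberField X →
        HodgeConjectureFor n X :=
  Iff.rfl

/-! ### The three registered stubs -/

/-- STUB 1 (INFRASTRUCTURE — a theorem in print; L-sized in the tree) — **conjugates exist.** For
`X` smooth projective over `ℂ`, every `σ ∈ Aut ℂ`, every degree `k` and every class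
`c ∈ Hᵏ(X(ℂ); ℂ)` there is a class `c' ∈ Hᵏ(X^σ(ℂ); ℂ)` conjugate to `c` in some conjugation chart
(`IsConjugateClass`): take Jouanolou's affine vector-bundle torsor `π : Y → X` (`Y` smooth affine,
`π^*` and `(π^σ)^*` bijective on cohomology), analytifications of `Y` and `Y^σ` on one model space
(GAGA), the integration de Rham family (natural and rationally normalised), represent `π^*c` by a
closed algebraic form `ξ` (Grothendieck: algebraic de Rham cohomology of a smooth affine variety
computes `H•(Y^an; ℂ)`), and let `c'` be the preimage under `(π^σ)^*` of the class of `ξ^σ`. Why it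
might fail: only through the tree's carriers (the `MForm` calculus `mextDeriv`/`wedge` must make the
realisation of a closed algebraic form closed; the named fact `exists_complexDeRhamIsoFamily` must be
upgraded to a NATURAL, rationally normalised family). Leans on: `ConjugationChart`,
`IsConjugateClass` (AbsoluteHodgeClasses); `IsAnalytification`, `exists_isAnalytification`,
`exists_complexDeRhamIsoFamily` (Transcendental); nothing in the tree constructs a chart today
(`Negative/HodgeImpliesAbsoluteHodge.nonempty_conjugationChart_of_isAbsoluteHodgeClass` records that
any proof of absoluteness must). [cite: Jouanolou1973, Lemme 1.5] [cite: Grothendieck1966, Thm. 1']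
[cite: CharlesSchnell2014Notes, §11.2.2 (11.2.2)–(11.2.3)] [cite: SerreGAGA1956, §2] -/
theorem stub_conjugate_exists :
    ∀ ⦃n : ℕ⦄ ⦃X : SchemeOver ℂ⦄, IsSmoothProjective n X →
      ∀ (σ : ℂ ≃+* ℂ) (k : ℕ) (c : complexBetti X k), ∃ c', IsConjugateClass σ X k c c' := by
  sorry

/-- STUB 2 (DELIGNE'S ABSOLUTENESS CONJECTURE ON ARITHMETIC VARIETIES — open) — **on a smooth
projective variety definable over a number field, every conjugate of a rational `(p,p)` class is a
twisted rational `(p,p)` class**: for `X ≅ X₀ ×_{K,σ₀} ℂ`, `c ∈ H²ᵖ(X(ℂ); ℂ)` rational of Hodge type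
`(p,p)`, `σ ∈ Aut ℂ` and any `σ`-conjugate `c'` of `c` (in any conjugation chart),
`c' = (2πi/σ(2πi))ᵖ · β` with `β` rational of type `(p,p)` on `X^σ` — the conjugation clause of
`IsAbsoluteHodgeClass`, i.e. Charles–Schnell Conj. 11.2.17 ("Hodge classes are absolute Hodge")
RESTRICTED to varieties over number fields (where `X^σ ≅ X₀ ×_{K,σσ₀} ℂ` is again arithmetic and only
the finitely many embeddings `K → ℂ` matter up to `Aut(ℂ/σ₀K)`, whose action on rational classes of
`X` is through the finite monodromy of the isotrivial family — Deligne's Principle B setting). Why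
plausibly true: implied by HC (cycle classes are absolute Hodge, Deligne 1982 Ex. 2.1(a)); a THEOREM
on abelian varieties (Deligne 1982 Thm. 2.11) and for motivated classes (André 1996, tree fact
`Andre1996_isAbsoluteHodgeClass_of_mem_motivatedClasses`); the standing expectation in general. Why
it might fail / why it is hard: no method produces absoluteness away from abelian/motivated classes;
a rational `(p,p)` class on an arithmetic variety with a non-Hodge conjugate refutes HC itself. As
typed it ALSO certifies that chart conjugation is single-valued on such classes
(`Negative/ChartConjugationUniqueness.conjugates_unique_of_forall_rational`) — Grothendieck's
comparison fragment, a theorem. Size: open problem. Leans on: `IsConjugateClass`, `periodTwist`,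
`conjugateVariety`. [cite: CharlesSchnell2014Notes, §11.2.5 Conj. 11.2.17 and Def. 11.2.3]
[cite: Deligne1982HodgeCycles, §2 Ex. 2.1(a), Prop. 2.9, Thm. 2.11] [cite: Andre1996Motifs, Thm. 0.6.2] -/
theorem stub_conjugate_isHodge_of_numberField :
    ∀ ⦃n : ℕ⦄ ⦃X : SchemeOver ℂ⦄, IsSmoothProjective n X → IsDefinableOverNumberField X →
      ∀ (p : ℕ) (c : complexBetti X (2 * p)), IsRationalClass c → IsOfHodgeType n X (2 * p) p p c →
        ∀ (σ : ℂ ≃+* ℂ) (c' : complexBetti (conjugateVariety σ X) (2 * p)),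
          IsConjugateClass σ X (2 * p) c c' →
            ∃ β : complexBetti (conjugateVariety σ X) (2 * p),
              IsRationalClass β ∧ IsOfHodgeType n (conjugateVariety σ X) (2 * p) p p β ∧
                c' = periodTwist σ p • β := by
  sorry

/-- STUB 3 (THE ARITHMETIC HEART — open, load-bearing) — **absolute Hodge classes on smooth
projective varieties definable over a number field are algebraic**: for `X ≅ X₀ ×_{K,σ₀} ℂ` and
`c ∈ H²ᵖ(X(ℂ); ℂ)` absolute Hodge (`IsAbsoluteHodgeClass`: rational, `(p,p)`, every conjugate a
twisted rational `(p,p)` class), `c ∈ algebraicClasses X p`. This is where the route's arithmetic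
bites: an absolute Hodge class on `X/K` has algebraic de Rham component defined over a finite
extension of `K` (Charles–Schnell Cor. 11.3.16), is potentially Tate (Deligne Prop. 2.9(b); tree
predicate `Motives.HodgeClassesArePotentiallyTate`), so Tate + Mumford–Tate (Moonen 2017), `p`-adic
variational Hodge (Bloch–Esnault–Kerz 2014) and CM/Shimura tools apply. Why it might fail / why it
is hard: it contains the algebraicity of WEIL CLASSES on CM abelian varieties of Weil type (absolute
by Deligne's theorem; by Deligne 1982 + André 1992 they govern all Hodge classes on CM abelian
varieties) — known in dimension 4 and partly 6 (Markman 2025; arXiv:2603.20268 §1), open beyond; a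
counterexample there also refutes standard conjecture B (André 1996 §6.3). By Voisin 2007 Prop. 1.2
(tree fact `voisin2007_hodgeConjecture_absolute_of_qbar`) this stub already gives HC for absolute
classes on ALL complex varieties. Size: open problem (the crux's real content once STUB 2 holds).
Leans on: `IsAbsoluteHodgeClass`, `algebraicClasses`. [cite: Deligne1982HodgeCycles, Prop. 2.9 and Thm. 2.11]
[cite: CharlesSchnell2014Notes, Cor. 11.3.16 and §11.2.5] [cite: Voisin2007HodgeLoci, Prop. 1.2]
[cite: Markman2025SecantWeil, §1.1] [cite: Moonen2017FamiliesMotives] -/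
theorem stub_absoluteHodge_algebraic_of_numberField :
    ∀ ⦃n : ℕ⦄ ⦃X : SchemeOver ℂ⦄, IsSmoothProjective n X → IsDefinableOverNumberField X →
      ∀ (p : ℕ) (c : complexBetti X (2 * p)), IsAbsoluteHodgeClass n X p c →
        c ∈ algebraicClasses X p := by
  sorry

/-! ### The composition: stub₁ → stub₂ → stub₃ → the crux, by name -/

/-- **THE LINE'S COMPOSITION** (kernel-checked, no `sorry`): if conjugates exist (STUB 1), every
conjugate of a rational `(p,p)` class on an arithmetic variety is a twisted rational `(p,p)` class
(STUB 2), and absolute Hodge classes on arithmetic varieties are algebraic (STUB 3), then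
`HCOverNumberFields`: for `X` smooth projective definable over a number field, the anti-vacuity
conjunct `Nonempty (HodgeModel n X)` is the proved tree theorem `HodgeModels_holds`
(`nonempty_hodgeModel_holds`), and a rational `(p,p)` class `c` is absolute Hodge by STUBS 1–2
(the definition `IsAbsoluteHodgeClass` assembled field by field), hence algebraic by STUB 3.
[cite: CharlesSchnell2014Notes, Def. 11.2.3 and §11.2.5] -/
theorem HCOverNumberFields_of :
    (∀ ⦃n : ℕ⦄ ⦃X : SchemeOver ℂ⦄, IsSmoothProjective n X →
      ∀ (σ : ℂ ≃+* ℂ) (k : ℕ) (c : complexBetti X k), ∃ c', IsConjugateClass σ X k c c') →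
    (∀ ⦃n : ℕ⦄ ⦃X : SchemeOver ℂ⦄, IsSmoothProjective n X → IsDefinableOverNumberField X →
      ∀ (p : ℕ) (c : complexBetti X (2 * p)), IsRationalClass c → IsOfHodgeType n X (2 * p) p p c →
        ∀ (σ : ℂ ≃+* ℂ) (c' : complexBetti (conjugateVariety σ X) (2 * p)),
          IsConjugateClass σ X (2 * p) c c' →
            ∃ β : complexBetti (conjugateVariety σ X) (2 * p),
              IsRationalClass β ∧ IsOfHodgeType n (conjugateVariety σ X) (2 * p) p p β ∧
                c' = periodTwist σ p • β) →
    (∀ ⦃n : ℕ⦄ ⦃X : SchemeOver ℂ⦄, IsSmoothProjective n X → IsDefinableOverNumberField X →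
      ∀ (p : ℕ) (c : complexBetti X (2 * p)), IsAbsoluteHodgeClass n X p c →
        c ∈ algebraicClasses X p) →
    Summit.HodgeConjecture.HodgeConjecture.Theses.QbarEnvelope.HCOverNumberFields := by
  intro h₁ h₂ h₃ n X hX hK
  refine ⟨(HodgeModels_holds n X).nonempty hX, fun p c hc hpp => ?_⟩
  exact h₃ hX hK p c
    ⟨hc, hpp, fun σ => ⟨h₁ hX σ (2 * p) c, fun c' hc' => h₂ hX hK p c hc hpp σ c' hc'⟩⟩

/-- **The crux, closed modulo exactly the three registered stubs.** -/
theorem HCOverNumberFields_of_stubs :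
    Summit.HodgeConjecture.HodgeConjecture.Theses.QbarEnvelope.HCOverNumberFields :=
  HCOverNumberFields_of stub_conjugate_exists stub_conjugate_isHodge_of_numberField
    stub_absoluteHodge_algebraic_of_numberField

end Summit.HodgeConjecture.HodgeConjecture.Cruxes.HCOverNumberFields.Birth

end
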